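import Literature.MathematicalPhysics.QuantumFieldTheory.Balaban1983to89.B4Lemma21Region
import Literature.MathematicalPhysics.QuantumFieldTheory.Balaban1983to89.B4Cor23RegionEta
import Literature.MathematicalPhysics.QuantumFieldTheory.Balaban1983to89.B4Lower18RegularRegion
import Literature.MathematicalPhysics.QuantumFieldTheory.Balaban1983to89.B4Lower18Regular
import Literature.MathematicalPhysics.QuantumFieldTheory.Balaban1983to89.B4Prop31Regular

/-!
# `Balaban1983to89.B4Eq12ExpFlow` — [Balaban1983RegularityDecay] (1.2) «U(A) = e^{qeηA}, q is an antisymmetric N × N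
matrix» for EVERY antisymmetric `q`: the flow `t ↦ e^{tq}` as an `OrthFlow`, its Lipschitz bound, and the regular-`A`
theorems of the lineage (Lemma 2.1, Cor. 2.3, (1.8), Prop. 3.1′) with their flow hypotheses discharged at the printed
generality

statement-level skeleton of published theorems with citation tags; proofs where landed; nothing here is a claim about the Yang–Mills mass gap

CITATION HEADER.  T. Bałaban, *Regularity and decay of lattice Green's functions*, Commun. Math. Phys. **89** (1983)
571–597, doi:10.1007/bf01214744 [Balaban1983RegularityDecay] (cell paper B4; held text
`paper:balaban1983-cmp89-regularity-decay`, journal page = PDF page + 570; p. 572).  Unit `lit-balaban-r01` gen 5 (B4 fold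
owner), HOME `run/shared/lean/pub/lit-balaban/`, SKELETON rows **B4.Eq1.2** ((1.2)), **B4.Lem2.1**, **B4.Cor2.3**,
**B4.Eq1.8**, **B4.Prop3.1'[II]** (the regular-`A` members).  Imports the five F-generic regular-field files it instantiates.

WHAT IS PRINTED (verbatim, p. 572).  *«The operators we are going to define depend on A through the function
U(A) = e^{qeηA}, q is an antisymmetric N × N matrix, where e is a real parameter. (1.2)»*

WHAT THIS MODULE PROVES (all in full).
* `expFlow q hq : OrthFlow ι` (§1) — for ANY finite index type `ι` (any `N`) and ANY `q` with `qᵀ = −q`, the one-parameter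
  group `U(t) = exp(tq)` (Mathlib's `NormedSpace.exp`; group law `Matrix.exp_add_of_commute`; orthogonality
  `U(t)ᵀU(t) = 1` from `Matrix.exp_transpose` and `qᵀ = −q`), so that the link variable of (1.2) is
  `U(A_b) = (expFlow q hq).U (eηA_b)`; `expFlow_U`, `expFlow_U_one`.
* `expFlow_lipschitz` (§2) — `|(U(t) − 1)v|² ≤ (ℓt)²|v|²` for all real `t` and all `v : ι → ℝ`, with
  `ℓ = (Σ_{ij} q_{ij}²)^{1/2} ≥ 0` (`expFlow_ell_nonneg`): the derivative of `u ↦ e^{uq}v` is `qe^{uq}v`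
  (`hasDerivAt_exp_smul_const'`), `|qw| ≤ ℓ|w|` (Cauchy–Schwarz) and `|e^{uq}v| = |v|` (orthogonality), then the mean
  value inequality (`Convex.norm_image_sub_le_of_norm_deriv_le`) in `EuclideanSpace ℝ ι`.  This is EXACTLY the pair of
  flow hypotheses `hℓ : 0 ≤ ℓ`, `hLip : ∀ t v, ((F.U t − 1)v)·((F.U t − 1)v) ≤ (ℓt)²(v·v)` carried by every F-generic
  regular-`A` theorem of the lineage, which before this file were discharged only for the `N = 2` rotation flow
  `OrthFlow.rot` (`B4Lower18Regular.rot_lipschitz`, `ℓ = 1`).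
* §3, the corollaries (each = the generic theorem at `F := expFlow q hq`, hypothesis-free in the flow):
  `lemma21Printed_regularRegion_exp` (Lemma 2.1 (2.15) on `B4Lemma21Region.regularCube`), `cor23Printed_regularPair_exp`
  (Cor. 2.3 (2.30) + its δG clause on `B4Cor23RegionEta.regularPairSetting`), `claim18Printed_regularRegion_exp` /
  `claim18Printed_regularBox_exp` ((1.8) on `B4Lower18RegularRegion.regularRegionSetting` /
  `B4Lower18Regular.regularBoxSetting`), `prop31Printed_regularRegion_exp` (Prop. 3.1′ (1.21)–(1.22) on
  `B4Prop31Regular.regularFormSetting`).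

HONEST SCOPE.  (1.2) for a FIXED `q` is a one-parameter (hence abelian) group of orthogonal matrices, which is what
`B4GaugeCovariance.OrthFlow` types; this file realises every printed (1.2) as such a flow and adds no claim about several
non-commuting generators.  The regular-field families, their regularity convention (1.7) and all constants are those of
the imported files, unchanged; nothing here touches the general-`Ω` Theorem (1.9)/(1.10) at `A ≠ 0` (the cell's reserve
item R9).  One `def` with body (`expFlow`) + one private plumbing `def` (`applyVec`); no `Prop` fact, no `sorry`; axioms
standard.
-/

namespace Literature.MathematicalPhysics.QuantumFieldTheory.Balaban1983to89.B4Eq12ExpFlow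

open scoped Matrix
open NormedSpace
open Literature.MathematicalPhysics.QuantumFieldTheory.Balaban1983to89.B4GaugeCovariance

noncomputable section

section Flow

variable {ι : Type*} [Fintype ι] [DecidableEq ι]

/-! ## §1. The one-parameter group `U(t) = e^{tq}` of (1.2), for EVERY antisymmetric `q` -/

/-- **[B4] (1.2) «U(A) = e^{qeηA}, q is an antisymmetric N × N matrix»**: the one-parameter group `t ↦ e^{tq}` of the
antisymmetric matrix `q` (any finite index type, any `N`), as an `OrthFlow` — the carrier of EVERY regular-`A` theorem of
the lineage (which so far was instantiated hypothesis-free only for the `N = 2` rotation `OrthFlow.rot`).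
[cite: Balaban1983RegularityDecay, (1.2) p.572] -/
def expFlow (q : Matrix ι ι ℝ) (hq : qᵀ = -q) : OrthFlow ι where
  U t := exp (t • q)
  map_zero := by rw [zero_smul, NormedSpace.exp_zero]
  map_add s t := by
    rw [add_smul]
    exact Matrix.exp_add_of_commute _ _ (((Commute.refl q).smul_left s).smul_right t)
  orth t := by
    rw [← Matrix.exp_transpose, Matrix.transpose_smul, hq, smul_neg, ← neg_smul]
    rw [← Matrix.exp_add_of_commute _ _ (((Commute.refl q).smul_left (-t)).smul_right t), neg_smul,
      neg_add_cancel, NormedSpace.exp_zero]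

/-- `U(t) = e^{tq}`. [cite: Balaban1983RegularityDecay, (1.2) p.572] -/
theorem expFlow_U (q : Matrix ι ι ℝ) (hq : qᵀ = -q) (t : ℝ) : (expFlow q hq).U t = exp (t • q) := rfl

/-- `U(1) = e^{q}`: every link variable `U(A_b) = e^{qeηA_b}` is `(expFlow q).U (eηA_b)`. [cite: Balaban1983RegularityDecay, (1.2) p.572] -/
theorem expFlow_U_one (q : Matrix ι ι ℝ) (hq : qᵀ = -q) : (expFlow q hq).U 1 = exp q := by
  rw [expFlow_U, one_smul]

/-! ## §2. The Lipschitz bound `|(U(t) − 1)v|² ≤ (ℓt)²|v|²` with `ℓ² = Σ_{ij} q_{ij}²` — the hypothesis `hLip` of the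
lineage's regular-`A` theorems -/

omit [DecidableEq ι] in
/-- Cauchy–Schwarz, row by row: `|qw|² ≤ (Σ_{ij} q_{ij}²)·|w|²`. [folklore] -/
private theorem dotProduct_mulVec_self_le (q : Matrix ι ι ℝ) (w : ι → ℝ) :
    (q *ᵥ w) ⬝ᵥ (q *ᵥ w) ≤ (∑ i, ∑ j, q i j ^ 2) * (w ⬝ᵥ w) := by
  have hw : w ⬝ᵥ w = ∑ j, w j ^ 2 := by simp [dotProduct, sq]
  rw [hw, Finset.sum_mul]
  unfold dotProduct
  refine Finset.sum_le_sum fun i _ => ?_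
  rw [← sq, Matrix.mulVec, dotProduct]
  exact Finset.sum_mul_sq_le_sq_mul_sq Finset.univ (fun j => q i j) w

/-- orthogonal matrices preserve `|·|²`. [folklore] -/
private theorem dotProduct_mulVec_self_of_orth (U : Matrix ι ι ℝ) (hU : Uᵀ * U = 1) (v : ι → ℝ) :
    (U *ᵥ v) ⬝ᵥ (U *ᵥ v) = v ⬝ᵥ v := by
  rw [Matrix.dotProduct_mulVec, ← Matrix.mulVec_transpose, Matrix.mulVec_mulVec, hU, Matrix.one_mulVec]

omit [DecidableEq ι] in
/-- the Euclidean norm of `toLp 2 w` squared is `w ⬝ᵥ w`. [folklore] -/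
private theorem norm_toLp_sq (w : ι → ℝ) : ‖(WithLp.toLp 2 w : EuclideanSpace ℝ ι)‖ ^ 2 = w ⬝ᵥ w := by
  rw [EuclideanSpace.norm_sq_eq]
  simp [dotProduct, sq]

/-- the linear map `A ↦ Av` into Euclidean space. [folklore] -/
private def applyVec (v : ι → ℝ) : Matrix ι ι ℝ →ₗ[ℝ] EuclideanSpace ℝ ι where
  toFun A := WithLp.toLp 2 (A *ᵥ v)
  map_add' A B := by rw [Matrix.add_mulVec]; rfl
  map_smul' r A := by rw [Matrix.smul_mulVec]; rfl

omit [DecidableEq ι] in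
/-- unfolding of the plumbing map `applyVec`. [folklore] -/
private theorem applyVec_apply (v : ι → ℝ) (A : Matrix ι ι ℝ) :
    applyVec v A = WithLp.toLp 2 (A *ᵥ v) := rfl

open scoped Matrix.Norms.Operator in
/-- **THE LIPSCHITZ BOUND `hLip`** of `B4Lemma21Region.lemma21Printed_regularRegion` & co. for the flow `e^{tq}`:
`|(e^{tq} − 1)v|² ≤ (ℓt)²|v|²` for all real `t` and all `v`, with `ℓ = (Σ_{ij} q_{ij}²)^{1/2}` — from
`d/dt e^{tq}v = qe^{tq}v`, `|qe^{tq}v| ≤ ℓ|e^{tq}v| = ℓ|v|` (orthogonality) and the mean value inequality.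
[cite: Balaban1983RegularityDecay, (1.2) p.572] -/
theorem expFlow_lipschitz (q : Matrix ι ι ℝ) (hq : qᵀ = -q) (t : ℝ) (v : ι → ℝ) :
    (((expFlow q hq).U t - 1) *ᵥ v) ⬝ᵥ (((expFlow q hq).U t - 1) *ᵥ v)
      ≤ (Real.sqrt (∑ i, ∑ j, q i j ^ 2) * t) ^ 2 * (v ⬝ᵥ v) := by
  haveI : CompleteSpace (Matrix ι ι ℝ) := FiniteDimensional.complete ℝ (Matrix ι ι ℝ)
  set ℓ : ℝ := Real.sqrt (∑ i, ∑ j, q i j ^ 2) with hℓ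
  have hℓ2 : ℓ ^ 2 = ∑ i, ∑ j, q i j ^ 2 := Real.sq_sqrt (by positivity)
  have hℓ0 : 0 ≤ ℓ := Real.sqrt_nonneg _
  -- the path `g(u) = e^{uq}v` in Euclidean space and its derivative
  set L : Matrix ι ι ℝ →L[ℝ] EuclideanSpace ℝ ι := LinearMap.toContinuousLinearMap (applyVec v) with hL
  set g : ℝ → EuclideanSpace ℝ ι := fun u => L (exp (u • q)) with hg
  have hderiv : ∀ u, HasDerivAt g (L (q * exp (u • q))) u := fun u =>
    L.hasFDerivAt.comp_hasDerivAt u (hasDerivAt_exp_smul_const' q u)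
  -- the bound on the derivative: `‖q e^{uq} v‖ ≤ ℓ‖v‖`
  have hvv : 0 ≤ v ⬝ᵥ v := by
    rw [show v ⬝ᵥ v = ∑ j, v j ^ 2 by simp [dotProduct, sq]]; positivity
  have hbound : ∀ u, ‖deriv g u‖ ≤ ℓ * Real.sqrt (v ⬝ᵥ v) := by
    intro u
    rw [(hderiv u).deriv]
    have hsq : ‖L (q * exp (u • q))‖ ^ 2 ≤ (ℓ * Real.sqrt (v ⬝ᵥ v)) ^ 2 := by
      rw [hL, LinearMap.coe_toContinuousLinearMap', applyVec_apply, norm_toLp_sq, ← Matrix.mulVec_mulVec,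
        mul_pow, hℓ2, Real.sq_sqrt hvv]
      calc (q *ᵥ (exp (u • q) *ᵥ v)) ⬝ᵥ (q *ᵥ (exp (u • q) *ᵥ v))
          ≤ (∑ i, ∑ j, q i j ^ 2) * ((exp (u • q) *ᵥ v) ⬝ᵥ (exp (u • q) *ᵥ v)) := dotProduct_mulVec_self_le q _
        _ = (∑ i, ∑ j, q i j ^ 2) * (v ⬝ᵥ v) := by
            have horth : (exp (u • q))ᵀ * exp (u • q) = 1 := (expFlow q hq).orth u
            rw [dotProduct_mulVec_self_of_orth _ horth]
    exact (pow_le_pow_iff_left₀ (norm_nonneg _) (by positivity) two_ne_zero).mp hsq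
  -- the mean value inequality on `[0, t]`
  have hmvi := Convex.norm_image_sub_le_of_norm_deriv_le (f := g) (s := Set.univ)
    (fun u _ => (hderiv u).differentiableAt) (fun u _ => hbound u) convex_univ (Set.mem_univ 0) (Set.mem_univ t)
  have hg0 : g t - g 0 = WithLp.toLp 2 ((((expFlow q hq).U t - 1) *ᵥ v)) := by
    simp only [hg, hL, LinearMap.coe_toContinuousLinearMap', applyVec_apply, zero_smul, NormedSpace.exp_zero]
    rw [← WithLp.toLp_sub, Matrix.sub_mulVec, Matrix.one_mulVec]
    rfl
  have key : (((expFlow q hq).U t - 1) *ᵥ v) ⬝ᵥ (((expFlow q hq).U t - 1) *ᵥ v) = ‖g t - g 0‖ ^ 2 := by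
    rw [hg0, norm_toLp_sq]
  rw [key]
  calc ‖g t - g 0‖ ^ 2 ≤ (ℓ * Real.sqrt (v ⬝ᵥ v) * ‖t - 0‖) ^ 2 := pow_le_pow_left₀ (norm_nonneg _) hmvi 2
    _ = (ℓ * t) ^ 2 * (v ⬝ᵥ v) := by
        rw [sub_zero, Real.norm_eq_abs, mul_pow, mul_pow, Real.sq_sqrt hvv, sq_abs]; ring

omit [DecidableEq ι] in
/-- the constant `ℓ = (Σ_{ij} q_{ij}²)^{1/2}` of `expFlow_lipschitz` is `≥ 0` (the hypothesis `hℓ`). [cite: Balaban1983RegularityDecay, (1.2) p.572] -/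
theorem expFlow_ell_nonneg (q : Matrix ι ι ℝ) : 0 ≤ Real.sqrt (∑ i, ∑ j, q i j ^ 2) := Real.sqrt_nonneg _

end Flow

/-! ## §3. The regular-`A` theorems of the lineage for the flow `e^{tq}`, EVERY antisymmetric `q`

Each theorem below is the corresponding F-generic theorem of the tree applied to `expFlow q hq` with its two flow
hypotheses `hℓ`, `hLip` DISCHARGED by `expFlow_lipschitz` (before this file: discharged only for `OrthFlow.rot`, `N = 2`). -/

section Corollaries

variable {d : ℕ} {ι : Type} [Fintype ι] [DecidableEq ι]

/-- **Lemma 2.1 (2.15)** on the regular-field cube family `B4Lemma21Region.regularCube`, for the flow `U = e^{tq}` of (1.2)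
with ANY antisymmetric `q` (any `N`): hypothesis-free in the flow. [cite: Balaban1983RegularityDecay, Lemma 2.1 (2.15) p.577; (1.2) p.572] -/
theorem lemma21Printed_regularRegion_exp (q : Matrix ι ι ℝ) (hq : qᵀ = -q) {a : ℝ} (ha : 0 < a) {c : ℝ} (hc : 0 ≤ c)
    {β : ℝ} (hβ : 0 < β) (M K : ℕ) :
    B4.Lemma21Printed (B4Lemma21Region.regularCube (d := d) (expFlow q hq) a c β M K) :=
  B4Lemma21Region.lemma21Printed_regularRegion (expFlow q hq) (expFlow_ell_nonneg q) (expFlow_lipschitz q hq)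
    ha hc hβ M K

/-- **Corollary 2.3 (2.30) + its δG clause** on the regular-field region-pair family `B4Cor23RegionEta.regularPairSetting`,
for the flow `U = e^{tq}` of (1.2) with ANY antisymmetric `q`. [cite: Balaban1983RegularityDecay, Cor. 2.3 (2.30) pp. 580–581; (1.2) p.572] -/
theorem cor23Printed_regularPair_exp (q : Matrix ι ι ℝ) (hq : qᵀ = -q) {a : ℝ} (ha : 0 < a) {c : ℝ} (hc : 0 ≤ c)
    {β : ℝ} (hβ : 0 < β) (M : ℕ) :
    B4.Cor23Printed (B4Cor23RegionEta.regularPairSetting (d := d) (expFlow q hq) a c β M) :=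
  B4Cor23RegionEta.cor23Printed_regularPair (expFlow q hq) (expFlow_ell_nonneg q) (expFlow_lipschitz q hq) ha hc hβ M

/-- **the in-text claim (1.8)** `⟨f, G_k(Ω,A)f⟩ ≥ γ|f|²` on the regular-field REGION family
`B4Lower18RegularRegion.regularRegionSetting`, for the flow `U = e^{tq}` of (1.2) with ANY antisymmetric `q`.
[cite: Balaban1983RegularityDecay, (1.8) p.573; (1.2) p.572] -/
theorem claim18Printed_regularRegion_exp (q : Matrix ι ι ℝ) (hq : qᵀ = -q) {a : ℝ} (ha : 0 < a) {c : ℝ} (hc : 0 ≤ c)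
    {β : ℝ} (hβ : 0 < β) :
    B4.Claim18Printed (B4Lower18RegularRegion.regularRegionSetting (d := d) (expFlow q hq) a c β) :=
  B4Lower18RegularRegion.claim18Printed_regularRegion (expFlow q hq) (expFlow_ell_nonneg q) (expFlow_lipschitz q hq)
    ha hc hβ

/-- **the in-text claim (1.8)** on the regular-field BOX family `B4Lower18Regular.regularBoxSetting`, for the flow
`U = e^{tq}` of (1.2) with ANY antisymmetric `q`. [cite: Balaban1983RegularityDecay, (1.8) p.573; (1.2) p.572] -/
theorem claim18Printed_regularBox_exp (q : Matrix ι ι ℝ) (hq : qᵀ = -q) {a : ℝ} (ha : 0 < a) {c' : ℝ} (hc' : 0 ≤ c')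
    {β : ℝ} (hβ : 0 < β) :
    B4.Claim18Printed (B4Lower18Regular.regularBoxSetting (d := d) (expFlow q hq) a c' β) :=
  B4Lower18Regular.claim18Printed_regularBox (expFlow q hq) (expFlow_ell_nonneg q) (expFlow_lipschitz q hq) ha hc' hβ

/-- **Proposition 3.1′ of [2] (1.21)–(1.22)** on the regular-field form family `B4Prop31Regular.regularFormSetting`, for the
flow `U = e^{tq}` of (1.2) with ANY antisymmetric `q`. [cite: Balaban1983RegularityDecay, Prop. 3.1′ (1.21)–(1.22) p.574; (1.2) p.572] -/
theorem prop31Printed_regularRegion_exp (q : Matrix ι ι ℝ) (hq : qᵀ = -q) {a : ℝ} (ha : 0 < a) {m2 : ℝ} (hm : 0 ≤ m2)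
    {C : ℝ} (hC : 0 ≤ C) {a₀ : ℝ} (ha₀ : 0 ≤ a₀) {p : ℝ} (hp : 0 < p) :
    B4.Prop31Printed (B4Prop31Regular.regularFormSetting (d := d) (expFlow q hq) a m2 C a₀ p) :=
  B4Prop31Regular.prop31Printed_regularRegion (expFlow q hq) (expFlow_ell_nonneg q) (expFlow_lipschitz q hq)
    ha hm hC ha₀ hp

end Corollaries

end

end Literature.MathematicalPhysics.QuantumFieldTheory.Balaban1983to89.B4Eq12ExpFlow
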